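import Literature.RepresentationTheory.HeisenbergGroup.SchrodingerL2HaarTransport
import Literature.Analysis.SegalBargmann.SchrodingerRepresentationL2
import Mathlib.MeasureTheory.Measure.Haar.Unique
import Mathlib.Analysis.Normed.Module.FiniteDimension
import HarnessLib

/-!
# The `L²` Schrödinger representation over a finite-dimensional REAL vector space is irreducible

Topic `RepresentationTheory/HeisenbergGroup`; namespace `Literature.RepresentationTheory.HeisenbergGroup.SchrodingerHaar`.
KERNEL ONLY: theorems; no definition, no named fact, no record, no `sorry`.

The archimedean factor of the `L²` model of [GelbartRogawski1991, §3.1 p. 454 L19–21]'s `ρ_ψ` is the Schrödinger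
representation `SchrodingerHaar.rep β ψ hψ hβ μ` (`SchrodingerL2Haar.lean`; [Weil1964, Chap. I n° 4, 11–13]) on
`L²(X, μ)` for a finite-dimensional real vector space `X` (`= (F ⊗ ℝ)ⁿ`), a Haar measure `μ`, and multipliers
`u ↦ ψ(β(u, y))` which are unitary characters `𝐞(λ(u))` of `X`.  Its irreducibility is von Neumann's theorem
[vonNeumann1931] / [Folland1989, §1.5 Prop. (1.43)]; the tree proves it for the coordinate model
`SegalBargmann.rhoRep σ` on `L²(ℝ^σ, dx)` (`rhoRep_irreducible`, via the Fock-space Schur lemma).  This file transports: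

* §1 `rep_dotPairing_fourierChar` — on `L²(ℝ^σ, dx)` with the dot pairing and `ψ = 𝐞`, `SchrodingerHaar.rep` IS
  `rhoRep σ` (same a.e. formula `𝐞(t + q·x) f(x + p)`); hence `irreducible_dotPairing_fourierChar`;
* §2 `irreducible_of_irreducible_of_semiconj_smul` — §3 of `SchrodingerL2HaarTransport` with unit scalars allowed in
  the intertwining relation (central characters need not match; uses `rep_mk_eq_smul_rep_mk_zero` of `SchrodingerL2Haar`);
* §3 **`irreducible_real`** — `X` a finite-dimensional real normed space with a Haar measure `μ`, `β : X × Y → R`,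
  `ψ : R → S¹` continuous, such that EVERY real linear functional `λ` on `X` is realised by a multiplier:
  `ψ(β(u, y)) = 𝐞(λ u)` for some `y`.  Then `L²(X, μ)` has no closed subspace invariant under `ρ(H)` other than `⊥`,
  `⊤`.  Proof: linear coordinates `T : ℝᵈ ≃L X`; `μ ∘ T = c · dx` (uniqueness of Haar measure); §1, the rescaling
  `irreducible_smul_measure_iff` and the transport `compMeasurePreserving_rep` of `SchrodingerL2HaarTransport`.

Nothing of the cited sources is asserted; everything is proved from Mathlib and the tree.

## References
* [vonNeumann1931] J. von Neumann, Math. Ann. 104 (1931) 570–578.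
* [Folland1989] G. B. Folland, *Harmonic Analysis in Phase Space* (1989), §1.3 (1.25), §1.5 Prop. (1.43).
* [Weil1964] A. Weil, Acta Math. 111 (1964), Chap. I n° 4 p. 149, n° 11–13.
* [GelbartRogawski1991] S. Gelbart, J. Rogawski, Invent. Math. 105 (1991), §3.1 p. 454 L19–21.
-/

set_option autoImplicit false

noncomputable section

open MeasureTheory Filter Set Complex
open scoped ENNReal Topology FourierTransform

namespace Literature.RepresentationTheory.HeisenbergGroup

namespace SchrodingerHaar

open Literature.Analysis.SegalBargmann

/-! ## §1 The coordinate model: `SchrodingerHaar.rep` on `L²(ℝ^σ, dx)` is `rhoRep σ` -/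

section Coordinates

variable (σ : Type) [Fintype σ]

/-- continuity of `u ↦ u · y` on `ℝ^σ`. [cite: Folland1989, §1.3 (1.25)] -/
theorem continuous_dotPairing_left (y : σ → ℝ) : Continuous fun u : σ → ℝ => dotPairing σ u y :=
  continuous_id.dotProduct continuous_const

variable [DecidableEq σ]

/-- **`SchrodingerHaar.rep` for `(ℝ^σ, u · y, 𝐞, dx)` is the tree's `rhoRep σ`**:
`𝐞(t - ½ p·q) e^{2πi q·x + πi p·q} f(x + p) = 𝐞(t + x·q) f(x + p)`. [cite: Folland1989, §1.3 (1.25)] -/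
theorem rep_dotPairing_fourierChar (h : HeisR σ) (f : Lp ℂ 2 (volume : Measure (σ → ℝ))) :
    rep (dotPairing σ) 𝐞 Real.continuous_fourierChar (continuous_dotPairing_left σ) volume h f = rhoRep σ h f := by
  obtain ⟨⟨p, q⟩, t⟩ := h
  apply Lp.ext
  filter_upwards [rep_coeFn (dotPairing σ) 𝐞 Real.continuous_fourierChar (continuous_dotPairing_left σ) volume
      ⟨(p, q), t⟩ f, Lp.coeFn_smul (((𝐞 (t - 2⁻¹ * (p ⬝ᵥ q)) : Circle) : ℂ)) (rho p q f), rho_coeFn p q f]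
    with x h1 h2 h3
  rw [h1, rhoRep_mk_apply, h2, Pi.smul_apply, h3, smul_eq_mul, ← mul_assoc]
  congr 1
  change ((𝐞 (t + x ⬝ᵥ q) : Circle) : ℂ) = ((𝐞 (t - 2⁻¹ * (p ⬝ᵥ q)) : Circle) : ℂ) * rhoMul p q x
  rw [Real.fourierChar_apply, Real.fourierChar_apply, rhoMul, ← Complex.exp_add]
  congr 1
  have e : x ⬝ᵥ q = ∑ k, q k * x k := by
    rw [dotProduct_comm]; rfl
  rw [e, dotProduct]
  push_cast
  ring

/-- **irreducibility of the coordinate model** `SchrodingerHaar.rep (dotPairing σ) 𝐞 … dx` (= `rhoRep σ`,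
`rhoRep_irreducible`). [cite: Folland1989, §1.5 Prop. (1.43)] -/
theorem irreducible_dotPairing_fourierChar (K : Submodule ℂ (Lp ℂ 2 (volume : Measure (σ → ℝ))))
    (hKc : IsClosed (K : Set (Lp ℂ 2 (volume : Measure (σ → ℝ)))))
    (hK : ∀ (h : HeisR σ), ∀ f ∈ K,
      rep (dotPairing σ) 𝐞 Real.continuous_fourierChar (continuous_dotPairing_left σ) volume h f ∈ K) :
    K = ⊥ ∨ K = ⊤ :=
  rhoRep_irreducible σ K hKc fun h f hf => by rw [← rep_dotPairing_fourierChar]; exact hK h f hf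

end Coordinates

/-! ## §2 Transfer of irreducibility along an intertwiner, up to unit scalars -/

section Semiconj

variable {E E' : Type*} [AddCommGroup E] [Module ℂ E] [TopologicalSpace E] [AddCommGroup E'] [Module ℂ E']
  [TopologicalSpace E']

/-- `irreducible_of_irreducible_of_semiconj` with scalars: if every `V ∘ ρ(g)` is `c • ρ'(g') ∘ V` for some `g'` and
some scalar `c`, irreducibility passes from `ρ` to `ρ'` (subspaces are stable under scalars).
[cite: Folland1989, §1.5 Prop. (1.43)] -/
theorem irreducible_of_irreducible_of_semiconj_smul {G G' : Type*} (ρ : G → E →ₗ[ℂ] E) (ρ' : G' → E' →ₗ[ℂ] E')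
    (V : E ≃L[ℂ] E') (hV : ∀ g : G, ∃ (g' : G') (c : ℂ), ∀ v : E, V (ρ g v) = c • ρ' g' (V v))
    (hirr : ∀ K : Submodule ℂ E, IsClosed (K : Set E) → (∀ (g : G), ∀ v ∈ K, ρ g v ∈ K) → K = ⊥ ∨ K = ⊤)
    (K' : Submodule ℂ E') (hK'c : IsClosed (K' : Set E')) (hK' : ∀ (g' : G'), ∀ v ∈ K', ρ' g' v ∈ K') :
    K' = ⊥ ∨ K' = ⊤ := by
  refine irreducible_of_irreducible_of_semiconj ρ (fun p : G' × ℂ => p.2 • ρ' p.1) V (fun g => ?_) hirr K' hK'c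
    fun p v hv => ?_
  · obtain ⟨g', c, h⟩ := hV g
    exact ⟨(g', c), h⟩
  · exact K'.smul_mem _ (hK' p.1 v hv)

end Semiconj

/-! ## §3 Irreducibility over a finite-dimensional real vector space -/

section Real

variable {R : Type*} [CommRing R] {X Y : Type*} [NormedAddCommGroup X] [NormedSpace ℝ X] [FiniteDimensional ℝ X]
  [Module R X] [AddCommGroup Y] [Module R Y] (β : X →ₗ[R] Y →ₗ[R] R) (ψ : AddChar R Circle) [TopologicalSpace R]
  (hψ : Continuous (ψ : R → Circle)) (hβ : ∀ y : Y, Continuous fun u : X => β u y)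
  [MeasurableSpace X] [BorelSpace X] (μ : Measure X) [μ.IsAddHaarMeasure]

/-- **Irreducibility of the `L²` Schrödinger representation over a finite-dimensional real vector space.**  `X` a
finite-dimensional real normed space with a Haar measure `μ`, `β : X × Y → R` an `R`-bilinear pairing continuous in
the first variable, `ψ : R → S¹` continuous, such that every real linear functional `l : X → ℝ` is realised by a
multiplier, `ψ(β(u, y)) = 𝐞(l u)` for some `y ∈ Y`.  Then a closed subspace of `L²(X, μ)` invariant under all
`ρ(h) = SchrodingerHaar.rep β ψ hψ hβ μ h` is `⊥` or `⊤` — the irreducibility of `ρ_∞` for the `L²` model of the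
adelic `ρ_ψ` (`X = (F ⊗ ℝ)ⁿ`, `ψ_∞ = 𝐞 ∘ Tr`). [cite: Folland1989, §1.5 Prop. (1.43)] [cite: vonNeumann1931, §5] -/
theorem irreducible_real (hY : ∀ l : X →ₗ[ℝ] ℝ, ∃ y : Y, ∀ u : X, ψ (β u y) = 𝐞 (l u))
    (K : Submodule ℂ (Lp ℂ 2 μ)) (hKc : IsClosed (K : Set (Lp ℂ 2 μ)))
    (hK : ∀ (h : Heisenberg (polar β)), ∀ f ∈ K, rep β ψ hψ hβ μ h f ∈ K) : K = ⊥ ∨ K = ⊤ := by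
  -- linear coordinates `T : ℝᵈ ≃L X` and the transported measure `μ ∘ T = c • dx`
  set d : ℕ := Module.finrank ℝ X with hd
  let T : (Fin d → ℝ) ≃L[ℝ] X := ContinuousLinearEquiv.ofFinrankEq (by rw [Module.finrank_fin_fun, hd])
  haveI : (Measure.map T.symm μ).IsAddHaarMeasure := T.symm.isAddHaarMeasure_map μ
  obtain ⟨c, hc0, hc, hc1⟩ : ∃ c : ℝ≥0∞, c ≠ 0 ∧ c ≠ ∞ ∧
      Measure.map T.symm μ = c • (volume : Measure (Fin d → ℝ)) := by
    refine ⟨((Measure.map T.symm μ).addHaarScalarFactor volume : ℝ≥0∞), ?_, ENNReal.coe_ne_top, ?_⟩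
    · exact ENNReal.coe_ne_zero.2
        (Measure.addHaarScalarFactor_pos_of_isAddHaarMeasure (Measure.map T.symm μ) volume).ne'
    · exact (Measure.isAddLeftInvariant_eq_smul (Measure.map T.symm μ) (volume : Measure (Fin d → ℝ))).trans
        (Measure.coe_nnreal_smul _ _).symm
  let S : (Fin d → ℝ) →+ X := T.toLinearEquiv.toLinearMap.toAddMonoidHom
  have hSapp : ∀ a, S a = T a := fun a => rfl
  have hS : MeasurePreserving S (c • (volume : Measure (Fin d → ℝ))) μ := by
    rw [← hc1]
    refine ⟨T.continuous.measurable, ?_⟩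
    change Measure.map T (Measure.map T.symm μ) = μ
    rw [Measure.map_map T.continuous.measurable T.symm.continuous.measurable]
    have e : (T : (Fin d → ℝ) → X) ∘ (T.symm : X → Fin d → ℝ) = id := funext fun x => T.apply_symm_apply x
    rw [e, Measure.map_id]
  have hS' : MeasurePreserving T.symm μ (c • (volume : Measure (Fin d → ℝ))) := by
    rw [← hc1]
    exact ⟨T.symm.continuous.measurable, rfl⟩
  -- the unitary `U : L²(μ) ≃ L²(c • dx)`, `F ↦ F ∘ T`
  obtain ⟨U, hU, -⟩ := exists_linearIsometryEquiv_compMeasurePreserving (S := (S : (Fin d → ℝ) → X))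
    (S' := (T.symm : X → Fin d → ℝ)) hS hS' (fun a => T.symm_apply_apply a) (fun b => T.apply_symm_apply b)
  -- irreducibility on `L²(ℝᵈ, c • dx)`
  have h₁ := (irreducible_smul_measure_iff (volume : Measure (Fin d → ℝ)) (dotPairing (Fin d)) 𝐞
    Real.continuous_fourierChar (continuous_dotPairing_left (Fin d)) hc0 hc).1
    (irreducible_dotPairing_fourierChar (Fin d))
  -- transfer along `V = U⁻¹`, matching `ρ₁((x₁, y₁), t₁)` with `𝐞(t₁) • ρ((T x₁, y₂), 0)`
  refine irreducible_of_irreducible_of_semiconj_smul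
    (fun h => rep (dotPairing (Fin d)) 𝐞 Real.continuous_fourierChar (continuous_dotPairing_left (Fin d))
      (c • (volume : Measure (Fin d → ℝ))) h)
    (fun h => rep β ψ hψ hβ μ h) U.symm.toContinuousLinearEquiv (fun g => ?_) h₁ K hKc hK
  obtain ⟨⟨x₁, y₁⟩, t₁⟩ := g
  -- a multiplier `y₂` realising the functional `u ↦ (T⁻¹ u) · y₁`
  obtain ⟨y₂, hy₂⟩ := hY ((dotPairing (Fin d)).flip y₁ ∘ₗ (T.symm : X →L[ℝ] (Fin d → ℝ)).toLinearMap)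
  have hy : ∀ a : Fin d → ℝ, ψ (β (S a) y₂) = 𝐞 (dotPairing (Fin d) a y₁) := fun a => by
    rw [hy₂ (S a), LinearMap.comp_apply, LinearMap.flip_apply, hSapp]
    exact congrArg (fun z : Fin d → ℝ => (𝐞 (dotPairing (Fin d) z y₁) : Circle)) (T.symm_apply_apply a)
  have ht : ψ (0 : R) = 𝐞 (0 : ℝ) := by rw [AddChar.map_zero_eq_one, AddChar.map_zero_eq_one]
  refine ⟨⟨(S x₁, y₂), 0⟩, ((𝐞 t₁ : Circle) : ℂ), fun v => ?_⟩
  have key := compMeasurePreserving_rep (dotPairing (Fin d)) β 𝐞 ψ Real.continuous_fourierChar hψ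
    (continuous_dotPairing_left (Fin d)) hβ (c • (volume : Measure (Fin d → ℝ))) μ hS (x₁ := x₁) hy ht
    (U.symm.toContinuousLinearEquiv v)
  rw [← hU, ← hU] at key
  change U (rep β ψ hψ hβ μ ⟨(S x₁, y₂), 0⟩ (U.symm v)) = rep (dotPairing (Fin d)) 𝐞 Real.continuous_fourierChar
    (continuous_dotPairing_left (Fin d)) (c • (volume : Measure (Fin d → ℝ))) ⟨(x₁, y₁), 0⟩ (U (U.symm v)) at key
  rw [LinearIsometryEquiv.apply_symm_apply] at key
  change U.symm (rep (dotPairing (Fin d)) 𝐞 Real.continuous_fourierChar (continuous_dotPairing_left (Fin d))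
    (c • (volume : Measure (Fin d → ℝ))) ⟨(x₁, y₁), t₁⟩ v) = ((𝐞 t₁ : Circle) : ℂ) • rep β ψ hψ hβ μ ⟨(S x₁, y₂), 0⟩
      (U.symm v)
  rw [rep_mk_eq_smul_rep_mk_zero, map_smul, ← key, LinearIsometryEquiv.symm_apply_apply]

end Real

end SchrodingerHaar

end Literature.RepresentationTheory.HeisenbergGroup

end
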